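import Literature.AlgebraicGeometry.Resolution.BlowupStalkCharts
import Literature.AlgebraicGeometry.Resolution.BlowupChartRegular
import Literature.AlgebraicGeometry.Resolution.RegularQuotientIdeal
import Literature.AlgebraicGeometry.Resolution.AdicCompletionRegular
import Literature.AlgebraicGeometry.Resolution.SNCStrataSmooth
import Literature.AlgebraicGeometry.Resolution.PermissibleCentres
import Literature.AlgebraicGeometry.Resolution.MonomialOrderReductionUnit
import Literature.AlgebraicGeometry.Resolution.MarkedIdeals
import HarnessLib

/-!
# [OURS · L1 W4.5(b) · EL♮] T-GOODPT-DICT — the good-point dictionary of the (P)/(TC) clauses: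
# blowing up keeps the ambient regular over regular points of a regular centre, STALK BY STALK

Crux `EquisingularLiftNat` = stmt-ResolutionOfSingularities-20038 / child `EquisingularLiftNatThree` = stmt-…-20148 (route
EquisingularLift), line `sections`, registered stub `stub_elnat_tcDeltaPointResolution` (skeleton v5.1); helper file
`--supports stmt-ResolutionOfSingularities-20148 --as helper`. Object T-GOODPT-DICT named by res-L1-w45b-lead-2 (STATUS 2026-08-27T08:46:09Z)
to res-L1-w45b-stub-2: the dictionary lemma the (P)/(TC) clauses make their USERS prove at each downstairs step — «`F₂ := Bl_x F₁`
(`x` closed, `F₁` regular at `x`) is regular at every point of the exceptional fibre, and `Bl_Z F₂` (`Z` a regular centre where it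
matters) is regular at every point over a REGULAR point of `V(Z)`». HONEST FRAMING: OURS (cell res-hironaka, slot W4.5(b)); NOT a
statement of any manuscript; Liu Thm. 8.1.19 (a) made stalk-local. AI-written, weaker than expert review. No `sorry`; standard axioms.

## Content (namespace `…Cruxes.EquisingularLiftNat.Sections`) — no Noetherian / integrality / finite-type hypothesis on the schemes

* `isRegularLocalRing_stalk_of_isBlowup_of_quotient` — **CORE**: `π : X′ → X` ANY blowing up along ANY ideal sheaf `J`, `x′ ∈ X′`
  with `R := 𝒪_{X,π x′}` a regular local ring and `R ⧸ J_{π x′}` a regular local ring ⟹ `𝒪_{X′,x′}` is a regular local ring.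
  (The centre is cut out in `R` by a quasi-regular sequence `c` with regular quotient —
  `exists_isQuasiRegular_span_eq_of_isRegularLocalRing_quotient`; the chart rings `R[J/cⱼ]` are regular —
  `isRegularRing_blowupChart`; `𝒪_{X′,x′}` is a localization of one of them at a prime — `IsBlowup.exists_reesChart_stalk`.)
* `isRegularLocalRing_stalk_of_isBlowup_of_not_mem_support` — off the centre the stalks do not change.
* `isRegularLocalRing_stalk_of_isBlowup_singleton` — **(P)**: the blow-up of a CLOSED point `x` with `𝒪_{X,x}` regular is regular at
  every point over `x` (`J_x = 𝔪_x`, `R/𝔪_x` a field).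
* `isRegularLocalRing_stalk_of_isBlowup_of_subscheme` — **(TC)**: the blow-up along `J` is regular at every point over a point `ι z`
  (`z ∈ V(J)`) at which both `X` and the closed subscheme `V(J)` are regular (`𝒪_{V(J),z} ≅ 𝒪_{X,ι z}/J_{ι z}`, tree
  `nonempty_stalkSubschemeEquiv`).
* `isRegularLocalRing_stalk_of_pointStep_then_centre` (`′`) — the (P)-then-(TC) pattern of `stub_elnat_tcDeltaPointResolution`: after
  the blow-up `υ` of a closed regular point `x` and a blow-up `υ′` along `Z ⊆ υ⁻¹{x}`, the ambient is regular at every point over a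
  regular point of `V(Z)` (resp. at every point over `x` whose image meets `V(Z)` only in regular points).

References: Liu, *Algebraic Geometry and Arithmetic Curves* (2002), Thm. 8.1.19 (a); Stacks 0804, 0BIQ; tree files cited above
(compare `IsBlowup.isRegularLocalRing_stalk_of_finite`, which needs an open regular locus, and `IsBlowup.isRegular_of_isRegular_subscheme`,
which needs global regularity).
-/

set_option linter.dupNamespace false -- mandated namespace `Summit.<Summit>.<Problem>` of this single-conjunct summit

noncomputable section

open CategoryTheory AlgebraicGeometry TopologicalSpace Topology IsLocalRing
open Literature.AlgebraicGeometry.Resolution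
open AlgebraicGeometry.Scheme.IdealSheafData

namespace Summit.ResolutionOfSingularities.ResolutionOfSingularities.Cruxes.EquisingularLiftNat.Sections

universe u

variable {X X' : Scheme.{u}} {π : X' ⟶ X} {J : X.IdealSheafData}

/-- **T-GOODPT-DICT, CORE (Liu Thm. 8.1.19 (a), stalk by stalk).** Let `π : X′ → X` be a blowing up along an ideal sheaf `J`
and `x′ ∈ X′`; if `𝒪_{X,π x′}` is a regular local ring and `𝒪_{X,π x′} ⧸ J_{π x′}` is a regular local ring, then `𝒪_{X′,x′}` is a
regular local ring. [cite: Liu2002, Thm. 8.1.19 (a)] -/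
theorem isRegularLocalRing_stalk_of_isBlowup_of_quotient (hπ : IsBlowup π J) (x' : X')
    [hreg : IsRegularLocalRing (X.presheaf.stalk (π.base x'))]
    (hq : IsRegularLocalRing (X.presheaf.stalk (π.base x') ⧸ stalkIdeal J (π.base x'))) :
    IsRegularLocalRing (X'.presheaf.stalk x') := by
  classical
  set R := ↑(X.presheaf.stalk (π.base x')) with hR
  haveI := hq
  -- the centre lies in the maximal ideal (its quotient is a local ring, hence non-trivial)
  have hle : stalkIdeal J (π.base x') ≤ maximalIdeal R := by
    refine IsLocalRing.le_maximalIdeal fun htop => ?_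
    have : Subsingleton (R ⧸ stalkIdeal J (π.base x')) := Ideal.Quotient.subsingleton_iff.mpr htop
    exact false_of_nontrivial_of_subsingleton (R ⧸ stalkIdeal J (π.base x'))
  -- a quasi-regular generating sequence with regular quotient
  obtain ⟨k, c, -, hspan, hc, -⟩ := exists_isQuasiRegular_span_eq_of_isRegularLocalRing_quotient hle
    (stalkIdeal J (π.base x') : Set R) (Ideal.span_eq _)
  haveI : IsRegularRing R := isRegularRing_of_isRegularLocalRing R
  haveI : IsRegularRing (R ⧸ Ideal.span (Set.range c)) := by
    rw [hspan]; exact isRegularRing_of_isRegularLocalRing _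
  -- `𝒪_{X′,x′}` is a localization of a chart ring at a prime
  obtain ⟨j, 𝔴, χ, -, hloc, -⟩ := hπ.exists_reesChart_stalk x' c hspan
  letI := χ.toAlgebra
  haveI : IsLocalization.AtPrime (X'.presheaf.stalk x') 𝔴.asIdeal := hloc
  haveI : IsRegularRing (chartRing c j) := isRegularRing_blowupChart c j hc
  exact IsRegularLocalRing.of_ringEquiv
    (IsLocalization.algEquiv 𝔴.asIdeal.primeCompl (Localization.AtPrime 𝔴.asIdeal) (X'.presheaf.stalk x')).toRingEquiv

/-- Off the centre a blowing up does not change the stalks: if `π x′ ∉ supp J` and `𝒪_{X,π x′}` is regular, so is `𝒪_{X′,x′}`.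
[cite: StacksProject, Tag 02OS] -/
theorem isRegularLocalRing_stalk_of_isBlowup_of_not_mem_support (hπ : IsBlowup π J) (x' : X')
    (hx : π.base x' ∉ J.support) [hreg : IsRegularLocalRing (X.presheaf.stalk (π.base x'))] :
    IsRegularLocalRing (X'.presheaf.stalk x') := by
  haveI := hπ.isIso_stalkMap_of_not_mem_support hx
  exact IsRegularLocalRing.of_ringEquiv (asIso (π.stalkMap x')).commRingCatIsoToRingEquiv

/-- **T-GOODPT-DICT (P): blowing up a closed point of a regular local ring keeps the ambient regular over it.** If `x ∈ X` is a
closed point with `𝒪_{X,x}` a regular local ring and `π : X′ → X` is a blowing up along the ideal sheaf `𝓘_{{x}}` of the reduced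
point, then `𝒪_{X′,x′}` is a regular local ring for every `x′` over `x` (`(𝓘_{{x}})_x = 𝔪_x`, whose quotient is a field).
[cite: Liu2002, Thm. 8.1.19 (a)] -/
theorem isRegularLocalRing_stalk_of_isBlowup_singleton {x : X} (hx : IsClosed ({x} : Set X))
    (hπ : IsBlowup π (vanishingIdeal ⟨{x}, hx⟩)) (x' : X') (hx' : π.base x' = x)
    (hreg : IsRegularLocalRing (X.presheaf.stalk x)) : IsRegularLocalRing (X'.presheaf.stalk x') := by
  subst hx'
  haveI := hreg
  refine isRegularLocalRing_stalk_of_isBlowup_of_quotient hπ x' ?_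
  rw [stalkIdeal_vanishingIdeal_singleton hx]
  letI : Field (X.presheaf.stalk (π.base x') ⧸ maximalIdeal (X.presheaf.stalk (π.base x'))) :=
    Ideal.Quotient.field _
  infer_instance

/-- All points over `x` at once. [cite: Liu2002, Thm. 8.1.19 (a)] -/
theorem forall_isRegularLocalRing_stalk_of_isBlowup_singleton {x : X} (hx : IsClosed ({x} : Set X))
    (hπ : IsBlowup π (vanishingIdeal ⟨{x}, hx⟩)) (hreg : IsRegularLocalRing (X.presheaf.stalk x)) :
    ∀ x' : X', π.base x' = x → IsRegularLocalRing (X'.presheaf.stalk x') :=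
  fun x' hx' => isRegularLocalRing_stalk_of_isBlowup_singleton hx hπ x' hx' hreg

/-- **T-GOODPT-DICT (TC): blowing up a centre keeps the ambient regular over the regular points of the centre at which the
ambient is regular.** `π : X′ → X` a blowing up along `J`, `z` a point of the closed subscheme `V(J)` with `𝒪_{V(J),z}` and
`𝒪_{X,ι z}` regular local rings ⟹ `𝒪_{X′,x′}` is regular for every `x′` over `ι z`. [cite: Liu2002, Thm. 8.1.19 (a)] -/
theorem isRegularLocalRing_stalk_of_isBlowup_of_subscheme (hπ : IsBlowup π J) (z : ↥J.subscheme)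
    (hz : IsRegularLocalRing (J.subscheme.presheaf.stalk z))
    (hreg : IsRegularLocalRing (X.presheaf.stalk (J.subschemeι.base z))) (x' : X')
    (hx' : π.base x' = J.subschemeι.base z) : IsRegularLocalRing (X'.presheaf.stalk x') := by
  haveI : IsRegularLocalRing (X.presheaf.stalk (π.base x')) := by rw [hx']; exact hreg
  refine isRegularLocalRing_stalk_of_isBlowup_of_quotient hπ x' ?_
  rw [hx']
  obtain ⟨e⟩ := nonempty_stalkSubschemeEquiv J z
  haveI := hz
  exact IsRegularLocalRing.of_ringEquiv e.symm

/-- All points over `ι z` at once, for a point `y = ι z` of `X` given with a witness `z ∈ V(J)`. [cite: Liu2002, Thm. 8.1.19 (a)] -/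
theorem forall_isRegularLocalRing_stalk_of_isBlowup_of_subscheme (hπ : IsBlowup π J) (z : ↥J.subscheme)
    (hz : IsRegularLocalRing (J.subscheme.presheaf.stalk z))
    (hreg : IsRegularLocalRing (X.presheaf.stalk (J.subschemeι.base z))) :
    ∀ x' : X', π.base x' = J.subschemeι.base z → IsRegularLocalRing (X'.presheaf.stalk x') :=
  fun x' hx' => isRegularLocalRing_stalk_of_isBlowup_of_subscheme hπ z hz hreg x' hx'

/-- **T-GOODPT-DICT, the (P)-then-(TC) pattern of the registered stub**: `υ : F₂ → F₁` the blow-up of a closed point `x` with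
`𝒪_{F₁,x}` regular, `υ′ : F₃ → F₂` a blow-up along an ideal sheaf `Z` supported in the exceptional fibre `υ⁻¹{x}`; then `F₃` is
regular at every point over a point of `V(Z)` at which `V(Z)` is regular. [cite: Liu2002, Thm. 8.1.19 (a)] -/
theorem isRegularLocalRing_stalk_of_pointStep_then_centre {F₁ F₂ F₃ : Scheme.{u}} {υ : F₂ ⟶ F₁} {υ' : F₃ ⟶ F₂} {x : F₁}
    (hx : IsClosed ({x} : Set F₁)) (hυ : IsBlowup υ (vanishingIdeal ⟨{x}, hx⟩))
    (hreg : IsRegularLocalRing (F₁.presheaf.stalk x)) {Z : F₂.IdealSheafData}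
    (hZ : (Z.support : Set F₂) ⊆ υ.base ⁻¹' {x}) (hυ' : IsBlowup υ' Z) (z : ↥Z.subscheme)
    (hz : IsRegularLocalRing (Z.subscheme.presheaf.stalk z)) (y : F₃) (hy : υ'.base y = Z.subschemeι.base z) :
    IsRegularLocalRing (F₃.presheaf.stalk y) := by
  have hmem : Z.subschemeι.base z ∈ (Z.support : Set F₂) := by
    rw [← Scheme.IdealSheafData.range_subschemeι]; exact ⟨z, rfl⟩
  have h2 : IsRegularLocalRing (F₂.presheaf.stalk (Z.subschemeι.base z)) :=
    isRegularLocalRing_stalk_of_isBlowup_singleton hx hυ _ (hZ hmem) hreg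
  exact isRegularLocalRing_stalk_of_isBlowup_of_subscheme hυ' z hz h2 y hy

/-- **Every point over the exceptional fibre after (P) then (TC)**: with the data of the previous lemma, `F₃` is regular at every
`y` with `υ (υ′ y) = x` provided `V(Z)` is regular at every point of `V(Z)` under `υ′ y` (vacuous off the centre).
[cite: Liu2002, Thm. 8.1.19 (a)] -/
theorem isRegularLocalRing_stalk_of_pointStep_then_centre' {F₁ F₂ F₃ : Scheme.{u}} {υ : F₂ ⟶ F₁} {υ' : F₃ ⟶ F₂} {x : F₁}
    (hx : IsClosed ({x} : Set F₁)) (hυ : IsBlowup υ (vanishingIdeal ⟨{x}, hx⟩))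
    (hreg : IsRegularLocalRing (F₁.presheaf.stalk x)) {Z : F₂.IdealSheafData} (hυ' : IsBlowup υ' Z) (y : F₃)
    (hy : υ.base (υ'.base y) = x)
    (hz : ∀ z : ↥Z.subscheme, Z.subschemeι.base z = υ'.base y → IsRegularLocalRing (Z.subscheme.presheaf.stalk z)) :
    IsRegularLocalRing (F₃.presheaf.stalk y) := by
  have h2 : IsRegularLocalRing (F₂.presheaf.stalk (υ'.base y)) :=
    isRegularLocalRing_stalk_of_isBlowup_singleton hx hυ _ hy hreg
  by_cases hmem : υ'.base y ∈ Z.support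
  · have hmem' : υ'.base y ∈ Set.range Z.subschemeι.base := by
      rw [Scheme.IdealSheafData.range_subschemeι]; exact hmem
    obtain ⟨z, hz'⟩ := hmem'
    exact isRegularLocalRing_stalk_of_isBlowup_of_subscheme hυ' z (hz z hz') (by rw [hz']; exact h2) y hz'.symm
  · haveI := h2
    exact isRegularLocalRing_stalk_of_isBlowup_of_not_mem_support hυ' y hmem

end Summit.ResolutionOfSingularities.ResolutionOfSingularities.Cruxes.EquisingularLiftNat.Sections

end
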